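/-
Copyright (c) 2026 the pub-hodgecm-mathlib formalisation cell (harness21).  Prover seat hodgecm-mathlib-K2E4-p11 (g7): Track B «K2-LIT»,
#184♮ = hLiu418 = stmt-HodgeConjecture-24832; socket #41 open surface (u-0c) — file I4, the INSTANCE `K2LiuSiegelEisensteinMiddleTermPackageInstance`
(LEAD F0P6-plan (g14) BATCH #51 (1); desk∕consumer K2E5-p17 (g8); census K2Liu-p02 (g7) a9fb81f54a0bfc2e): SKELETON, hypothesis-first on I1∕I2∕I3's letters.
-/
import Summits.HodgeConjecture.HodgeConjecture.Theorems.K2LiuMiddleCellPackageOfFacesGrowth       -- ★ (β0-4)′ p861557 (K2Liu-p02): `exists_middle_package_of_faces'`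
import Summits.HodgeConjecture.HodgeConjecture.Theorems.K2LiuSiegelEisensteinBigCellTermPackage   -- ★ (K2Liu-p13): the `X := H(𝔸)` plumbing `adelicHeightGL_bdd_on_compact` (+ the K2Liu curve frame `HA`, `unipDelta`, `SiegelDeltaQuot`)
import HarnessLib

/-!
# Crux `HLiu418`, socket #41, open surface (u-0c), FILE I4 — `K2LiuSiegelEisensteinMiddleTermPackageInstance`: THE MIDDLE-CELL TERM PACKAGE `E₇` OF THE TOP's
# EDITION 4a′, FROM ★ (β0-4)′ AT `X := H(𝔸)`, HYPOTHESIS-FIRST ON THE I1∕I2∕I3 LETTERS (skeleton; letters discharged as they land)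

Cell `hodgecm-mathlib`, crux item hLiu418 = `stmt-HodgeConjecture-24832`, route of record `HCCMUnconditional`; squad K2 ∕ K2Liu, road `K2_Liu`,
socket #41 `sig_K2LiuSiegelEisensteinContinuation`; LEAD F0P6-plan (g14) BATCH #51 (1) «I4 the INSTANCE → K2E4-p11: imports I1∕I2∕I3 + ★ p861557 primed head; `exact
exists_middle_package_of_faces' …` + rescaling to ed. 4a∕4a′ `h7eq`; types the skeleton hypothesis-first TODAY with I1∕I2 BY VALUE, discharges as they ★».  THEOREMS ONLY (no `def`,
no `instance`, no `notation`, no named-fact hypothesis, no `sorry`); lane `--supports stmt-HodgeConjecture-24832 --as helper` (count-neutral helper; closes no socket by itself).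

WHAT.  ★ ed. 4a′ `K2LiuSiegelEisensteinConstantTermFiniteness.exists_constantTerm_package_of_cells` (K2E5-p17) consumes a middle-cell package `E₇` through the five binders
`E₇ h7d h7c h7eq h7g` — (iv) `h7eq : n∕2 < re s → E₇ s h = (∏_{p∈P}(s − p)) · ∫ β(u) • Σ'_{q ∈ REST} f_s(q.out · (u · h)) dνN` (UN-normalised).  ★ (β0-4)′
`exists_middle_package_of_faces'` (K2Liu-p02) produces such an `E₇` for ANY space `X` with a height, from the faces of the middle cell: the `W`-package of `K`-types (I3, ★ p861665's
output), the untwisted inner family `φ` with its flat laws (I1), the Iwasawa–Levi coordinate `m x` with its height comparison (I2, ★ p861770), a row section `γ` (★ p861585), the idele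
class domain, and the middle-orbit identification `hMID : MID s x = c₀ · Σ'_p φ s x (γ_p · m x)` with the continuity `hMIDc`.  THIS FILE is the instance at the K2Liu curve frame:
`X := H(𝔸) = HA`, `height := adelicHeightGL (n+n) ∘ (↑)` (positivity ★ `adelicHeightGL_pos_holds`, bounded on compacts ★ `adelicHeightGL_bdd_on_compact`), `c := n∕2` (`n = 2`),
`MID s h :=` ed. 4a′'s integrand VERBATIM, `P := {½}` (`(s − ½) = ∏_{p∈{½}}(s − p)`), the idele class domain by value (★ `exists_isIdeleClassDomain` pays it under `[BorelSpace (ideleGroup L)]`), `L` totally complex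
(`IsCMField.isTotallyComplex`); OUTPUT = the four ed. 4a′ binders `h7d h7c h7eq h7g` VERBATIM at `P = {½}` (the big cell's `P₈ = {½}`, ★ `K2LiuSiegelEisensteinBigCellTermPackageCM`).
VISIBLE LETTERS (by value, each with its payer): the Haar measures `ν μ μinf`; the level data `S γl hγ0 hγ1`; the `W`-package `W hWstab hWlaw hWlev hWcont hWext` + `hφW hφbd` (★ I3
`K2LiuSiegelMiddleTermKTypes.exists_KTypes_package`'s output) + `hφhol` (★ (β0-hol)); the inner family `φ hφT hφN` (I1 `K2LiuSiegelMiddleTermInnerFamily`, K2E5-p16); `mx hC₀ hA₀ hmx`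
(★ I2 `K2LiuSiegelIwasawaLeviCoordinate.exists_iwasawaLeviCoordinate` + ★ height comparisons); `γ hγ` (★ p861585 `exists_rowSection₂`, kept visible because `hMID` names `γ`); `c₀` and
**`hMID`** (★ α3-2 `middle_cell_eq_tsum` + ★ I2 `K2LiuSiegelIwasawaLeviRewriting` + ★ `middle_eq_tsum_untwisted`); **`hMIDc`** (continuity of the un-normalised middle term in `h` on
`n∕2 < re s` — dominated convergence over `REST × νN` with ★ ed. 4a′ §1's finiteness; this file's own next edition).
* §1 HEAD **`exists_middleTerm_package`**.
HONEST LABEL.  Count-neutral helper; it retires nothing by itself: `HC_CM` is proved only modulo the 7 printed citations (2 remaining named inputs: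
hLiu418 = `stmt-HodgeConjecture-24832`, h413 = `stmt-HodgeConjecture-24833`) until rung 0 closes.

## References
* [MoeglinWaldspurger1995] C. Mœglin, J.-L. Waldspurger, *Spectral decomposition and Eisenstein series* (1995), II.1.7, IV.1.8–IV.1.9.
* [Tan1999] V. Tan, *Poles of Siegel Eisenstein series on U(n,n)*, Canad. J. Math. 51 (1999), §4 Prop. 4.1, Prop. 4.8.
* [CogdellAnalyticTheory2004] J. Cogdell, *Lectures on L-functions, converse theorems* (2004), §2.3 Thm. 2.2.   * [KudlaRallis1994] S. Kudla, S. Rallis, Ann. of Math. 140 (1994), §1.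
-/

set_option autoImplicit false
set_option linter.dupNamespace false -- the mandated namespace repeats `HodgeConjecture.HodgeConjecture`

noncomputable section

open MeasureTheory Measure NumberField NumberField.mixedEmbedding IsDedekindDomain Set Filter Topology Metric
open scoped NNReal ENNReal Matrix BigOperators
open Literature.NumberTheory.Automorphic
open Literature.NumberTheory.GaloisRepresentations (ideleGroup)
open Literature.NumberTheory.GelbartRogawski1991 Literature.NumberTheory.GelbartRogawski1991.GRConstruction
open Literature.NumberTheory.K2Lit.SiegelDoubled
open Summit.HodgeConjecture.HodgeConjecture.Cruxes.HLiu418.K2LiuGL2FlatSectionFiniteData (ofFinite_mem)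
open Summit.HodgeConjecture.HodgeConjecture.Cruxes.HLiu418.K2LiuMiddleCellPackageOfFacesGrowth (exists_middle_package_of_faces')
open Summit.HodgeConjecture.HodgeConjecture.Cruxes.HLiu418.K2LiuSiegelEisensteinBigCellTermPackage (adelicHeightGL_bdd_on_compact)

namespace Summit.HodgeConjecture.HodgeConjecture.Cruxes.HLiu418.K2LiuSiegelEisensteinMiddleTermPackageInstance

variable (L : Type) [Field L] [NumberField L] [IsCMField L] {N M n : ℕ} (e : Fin N × Fin M ≃ Fin n)
  (dV : Fin N → L) (hdV : ∀ i, IsCMField.complexConj L (dV i) = dV i)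
  (dW : Fin M → L) (hdW : ∀ i, IsCMField.complexConj L (dW i) = dW i)
variable [MeasurableSpace (unipDelta L e dV hdV dW hdW)] [BorelSpace (unipDelta L e dV hdV dW hdW)]

/-! ## §1 HEAD: the middle-cell term package of edition 4a′ at `P = {½}` -/

/-- **(u-0c) I4 — THE MIDDLE-CELL TERM PACKAGE `E₇` AT THE CURVE FRAME, SKELETON.**  For `n = 2`, a measure `νN` on `N_Δ(𝔸)`, a weight `β`, the unipotent Weyl labels `wq`, a family
`f_s`, and BY VALUE the faces of ★ (β0-4)′ read at `X := H(𝔸)` (`height = adelicHeightGL (n+n)`): Haar measures `ν μ μinf`, level data, the `W`-package of `K`-types (★ I3's output),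
the inner family `φ` with its flat laws, holomorphy, `K`-restriction and height bound, the Iwasawa–Levi coordinate `m x` with its height comparison (★ I2), a row section `γ` (★
`exists_rowSection₂`), and the identification `hMID` ∕ continuity `hMIDc` of the UN-normalised middle term `MID s h := ∫ β(u) • Σ'_{q∈REST} f_s(q.out·(u·h)) dνN` on `n∕2 < re s`:
**there is `E₇` with ed. 4a′'s `h7d`, `h7c`, `h7eq` (at `P = {½}`) and `h7g`** — ★ `exists_middle_package_of_faces'` (`c := n∕2`, `𝓕` by value — ★ `exists_isIdeleClassDomain`, `L` totally complex by `IsCMField.isTotallyComplex`).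
[cite: MoeglinWaldspurger1995, II.1.7, IV.1.9] [cite: Tan1999, §4 Prop. 4.8] [cite: CogdellAnalyticTheory2004, §2.3 Thm. 2.2] -/
theorem exists_middleTerm_package (hn : n = 2)
    [MeasurableSpace (AdeleRing (𝓞 L) L)] [BorelSpace (AdeleRing (𝓞 L) L)]
    (ν : Measure (ideleGroup L)) [ν.IsHaarMeasure] (μ : Measure (Fin 2 → AdeleRing (𝓞 L) L)) [μ.IsAddHaarMeasure]
    (μinf : Measure (mixedSpace L)ˣ) [μinf.IsHaarMeasure]
    (S : Finset (HeightOneSpectrum (𝓞 L))) (γl : ∀ v : HeightOneSpectrum (𝓞 L), ValuativeRel.ValueGroupWithZero (v.adicCompletion L))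
    (hγ0 : ∀ v ∈ S, γl v ≠ 0) (hγ1 : ∀ v ∈ S, γl v < 1)
    (W : Submodule ℂ (↥(standardMaximalCompactGL 2 L) → ℂ)) [FiniteDimensional ℂ W]
    (hWstab : ∀ B ∈ W, ∀ k₀ : ↥(standardMaximalCompactGL 2 L), (fun k => B (k * k₀)) ∈ W)
    (hWlaw : ∀ B ∈ W, ∀ p k : ↥(standardMaximalCompactGL 2 L),
    ((p : GL (Fin 2) (AdeleRing (𝓞 L) L)) : Matrix (Fin 2) (Fin 2) (AdeleRing (𝓞 L) L)) 1 0 = 0 → B (p * k) = B k)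
    (hWlev : ∀ B ∈ W, ∀ (k : ↥(standardMaximalCompactGL 2 L)) (r : GL (Fin 2) (FiniteAdeleRing (𝓞 L) L)) (hr : r ∈ glFiniteIntegralLevel 2 L),
    (∀ v ∈ S, GLn.evalAt 2 L v r ∈ congruenceGL 2 (γl v)) →
      B ⟨(k : GL (Fin 2) (AdeleRing (𝓞 L) L)) * GLn.ofFinite 2 L r, (standardMaximalCompactGL 2 L).mul_mem k.2 (ofFinite_mem hr)⟩ = B k)
    (hWcont : ∀ B ∈ W, Continuous B)
    (hWext : ∀ B ∈ W, ∃ bB : ℂ → GL (Fin 2) (AdeleRing (𝓞 L) L) → ℂ,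
    (∀ s : ℂ, 0 < s.re → ∀ (d : Fin 2 → (AdeleRing (𝓞 L) L)ˣ) (g : GL (Fin 2) (AdeleRing (𝓞 L) L)),
      bB s (glDiagonal 2 (AdeleRing (𝓞 L) L) d * g) =
        ((IdeleClassGroup.ideleNorm L (d 0) : ℝ) : ℂ) ^ (s + 1 / 2) * ((IdeleClassGroup.ideleNorm L (d 1) : ℝ) : ℂ) ^ (-(s + 1 / 2)) * bB s g) ∧
    (∀ s : ℂ, 0 < s.re → ∀ u g : GL (Fin 2) (AdeleRing (𝓞 L) L), (u : Matrix (Fin 2) (Fin 2) (AdeleRing (𝓞 L) L)) 1 0 = 0 →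
      (u : Matrix (Fin 2) (Fin 2) (AdeleRing (𝓞 L) L)) 0 0 = 1 → (u : Matrix (Fin 2) (Fin 2) (AdeleRing (𝓞 L) L)) 1 1 = 1 → bB s (u * g) = bB s g) ∧
    (∀ s : ℂ, 0 < s.re → ∀ (k : GL (Fin 2) (AdeleRing (𝓞 L) L)) (hk : k ∈ standardMaximalCompactGL 2 L), bB s k = B ⟨k, hk⟩))
    (φ : ℂ → HA L e dV hdV dW hdW → GL (Fin 2) (AdeleRing (𝓞 L) L) → ℂ)
    (hφT : ∀ (s : ℂ) (x : HA L e dV hdV dW hdW), 0 < s.re → ∀ (d : Fin 2 → (AdeleRing (𝓞 L) L)ˣ) (g : GL (Fin 2) (AdeleRing (𝓞 L) L)),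
    φ s x (glDiagonal 2 (AdeleRing (𝓞 L) L) d * g) =
      ((IdeleClassGroup.ideleNorm L (d 0) : ℝ) : ℂ) ^ (s + 1 / 2) * ((IdeleClassGroup.ideleNorm L (d 1) : ℝ) : ℂ) ^ (-(s + 1 / 2)) * φ s x g)
    (hφN : ∀ (s : ℂ) (x : HA L e dV hdV dW hdW), 0 < s.re → ∀ u g : GL (Fin 2) (AdeleRing (𝓞 L) L), (u : Matrix (Fin 2) (Fin 2) (AdeleRing (𝓞 L) L)) 1 0 = 0 →
    (u : Matrix (Fin 2) (Fin 2) (AdeleRing (𝓞 L) L)) 0 0 = 1 → (u : Matrix (Fin 2) (Fin 2) (AdeleRing (𝓞 L) L)) 1 1 = 1 → φ s x (u * g) = φ s x g)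
    (hφW : ∀ (s : ℂ) (x : HA L e dV hdV dW hdW), 0 < s.re → (fun k : ↥(standardMaximalCompactGL 2 L) => φ s x k) ∈ W)
    (hφhol : ∀ (x : HA L e dV hdV dW hdW) (k : ↥(standardMaximalCompactGL 2 L)), DifferentiableOn ℂ (fun s => φ s x k) {s : ℂ | 0 < s.re})
    (hφbd : ∀ z : ℂ, 0 < z.re → ∃ C A r : ℝ, 0 ≤ C ∧ 0 ≤ A ∧ 0 < r ∧ ∀ s : ℂ, dist s z < r →
    ∀ (x : HA L e dV hdV dW hdW) (k : ↥(standardMaximalCompactGL 2 L)), ‖φ s x k‖ ≤ C * adelicHeightGL (n + n) L (x : GL (Fin (n + n)) (AdeleRing (𝓞 L) L)) ^ A)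
    (mx : HA L e dV hdV dW hdW → GL (Fin 2) (AdeleRing (𝓞 L) L)) {C₀ A₀ : ℝ} (hC₀ : 0 ≤ C₀) (hA₀ : 0 ≤ A₀)
    (hmx : ∀ x : HA L e dV hdV dW hdW, adelicHeightGL 2 L (mx x) ≤ C₀ * adelicHeightGL (n + n) L (x : GL (Fin (n + n)) (AdeleRing (𝓞 L) L)) ^ A₀)
    (γ : Projectivization L (Fin 2 → L) → GL (Fin 2) L)
    (hγ : ∀ p, ∃ cL : L, cL ≠ 0 ∧ (Pi.single 1 1 : Fin 2 → L) ᵥ* (γ p : Matrix (Fin 2) (Fin 2) L) = cL • p.rep)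
    (νN : Measure (unipDelta L e dV hdV dW hdW)) (β : unipDelta L e dV hdV dW hdW → ℝ≥0∞)
    (wq : unipDeltaRat L e dV hdV dW hdW → ratH L e dV hdV dW hdW) (f : ℂ → HA L e dV hdV dW hdW → ℂ)
    {𝓕 : Set (ideleGroup L)} (h𝓕 : IsIdeleClassDomain L 𝓕)
    (c₀ : ℂ)
    (hMID : ∀ (s : ℂ) (h : HA L e dV hdV dW hdW), (n : ℝ) / 2 < s.re →
      (∫ u, (β u).toReal •
        (∑' q : ↥(({Quotient.mk (MulAction.orbitRel (siegelDeltaRat L e dV hdV dW hdW) (ratH L e dV hdV dW hdW)) 1} ∪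
            Set.range (fun ν : unipDeltaRat L e dV hdV dW hdW =>
              (Quotient.mk (MulAction.orbitRel (siegelDeltaRat L e dV hdV dW hdW) (ratH L e dV hdV dW hdW)) (wq ν) :
                SiegelDeltaQuot L e dV hdV dW hdW)))ᶜ : Set (SiegelDeltaQuot L e dV hdV dW hdW)),
          f s ((((Quotient.out (q : SiegelDeltaQuot L e dV hdV dW hdW) : ratH L e dV hdV dW hdW) : HA L e dV hdV dW hdW)) *
            ((u : HA L e dV hdV dW hdW) * h))) ∂νN) =
        c₀ * ∑' p : Projectivization L (Fin 2 → L), φ s h (Matrix.GeneralLinearGroup.map (algebraMap L (AdeleRing (𝓞 L) L)) (γ p) * mx h))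
    (hMIDc : ∀ s : ℂ, (n : ℝ) / 2 < s.re → Continuous fun h : HA L e dV hdV dW hdW => ∫ u, (β u).toReal •
        (∑' q : ↥(({Quotient.mk (MulAction.orbitRel (siegelDeltaRat L e dV hdV dW hdW) (ratH L e dV hdV dW hdW)) 1} ∪
            Set.range (fun ν : unipDeltaRat L e dV hdV dW hdW =>
              (Quotient.mk (MulAction.orbitRel (siegelDeltaRat L e dV hdV dW hdW) (ratH L e dV hdV dW hdW)) (wq ν) :
                SiegelDeltaQuot L e dV hdV dW hdW)))ᶜ : Set (SiegelDeltaQuot L e dV hdV dW hdW)),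
          f s ((((Quotient.out (q : SiegelDeltaQuot L e dV hdV dW hdW) : ratH L e dV hdV dW hdW) : HA L e dV hdV dW hdW)) *
            ((u : HA L e dV hdV dW hdW) * h))) ∂νN) :
    ∃ E₇ : ℂ → HA L e dV hdV dW hdW → ℂ,
      (∀ h : HA L e dV hdV dW hdW, DifferentiableOn ℂ (fun s => E₇ s h) {s : ℂ | 0 < s.re}) ∧
      (∀ s : ℂ, 0 < s.re → Continuous (E₇ s)) ∧
      (∀ (s : ℂ) (h : HA L e dV hdV dW hdW), (n : ℝ) / 2 < s.re →
        E₇ s h = (∏ p ∈ ({(1 / 2 : ℂ)} : Finset ℂ), (s - p)) * ∫ u, (β u).toReal •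
        (∑' q : ↥(({Quotient.mk (MulAction.orbitRel (siegelDeltaRat L e dV hdV dW hdW) (ratH L e dV hdV dW hdW)) 1} ∪
            Set.range (fun ν : unipDeltaRat L e dV hdV dW hdW =>
              (Quotient.mk (MulAction.orbitRel (siegelDeltaRat L e dV hdV dW hdW) (ratH L e dV hdV dW hdW)) (wq ν) :
                SiegelDeltaQuot L e dV hdV dW hdW)))ᶜ : Set (SiegelDeltaQuot L e dV hdV dW hdW)),
          f s ((((Quotient.out (q : SiegelDeltaQuot L e dV hdV dW hdW) : ratH L e dV hdV dW hdW) : HA L e dV hdV dW hdW)) *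
            ((u : HA L e dV hdV dW hdW) * h))) ∂νN) ∧
      (∀ z : ℂ, 0 < z.re → ∃ C A r : ℝ, 0 < r ∧ ∀ s : ℂ, dist s z < r → ∀ h : HA L e dV hdV dW hdW,
        ‖E₇ s h‖ ≤ C * adelicHeightGL (n + n) L (h : GL (Fin (n + n)) (AdeleRing (𝓞 L) L)) ^ A) := by
  subst hn
  haveI : IsTotallyComplex L := IsCMField.isTotallyComplex L
  have hc : (1 : ℝ) / 2 ≤ ((2 : ℕ) : ℝ) / 2 := by norm_num
  obtain ⟨E₇, hd, hcont, heq, hgr⟩ := exists_middle_package_of_faces' (ν := ν) (μ := μ) (μinf := μinf) (S := S) (γl := γl) (hγ0 := hγ0) (hγ1 := hγ1)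
    (height := fun x : HA L e dV hdV dW hdW => adelicHeightGL (2 + 2) L (x : GL (Fin (2 + 2)) (AdeleRing (𝓞 L) L)))
    (hpos := fun x => adelicHeightGL_pos_holds _) (hcpt := adelicHeightGL_bdd_on_compact L e dV hdV dW hdW)
    (W := W) (hWstab := hWstab) (hWlaw := hWlaw) (hWlev := hWlev) (hWcont := hWcont) (hWext := hWext)
    (φ := φ) (hφT := hφT) (hφN := hφN) (hφW := hφW) (hφhol := hφhol) (hφbd := hφbd) (mx := mx) (hC₀ := hC₀) (hA₀ := hA₀) (hmx := hmx) (γ := γ) (hγ := hγ)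
    (h𝓕 := h𝓕) (hHpos := fun gg => adelicHeightGL_pos_holds _) (hc := hc) (c₀ := c₀)
    (MID := (fun (s : ℂ) (h : HA L e dV hdV dW hdW) => ∫ u, (β u).toReal •
        (∑' q : ↥(({Quotient.mk (MulAction.orbitRel (siegelDeltaRat L e dV hdV dW hdW) (ratH L e dV hdV dW hdW)) 1} ∪
            Set.range (fun ν : unipDeltaRat L e dV hdV dW hdW =>
              (Quotient.mk (MulAction.orbitRel (siegelDeltaRat L e dV hdV dW hdW) (ratH L e dV hdV dW hdW)) (wq ν) :
                SiegelDeltaQuot L e dV hdV dW hdW)))ᶜ : Set (SiegelDeltaQuot L e dV hdV dW hdW)),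
          f s ((((Quotient.out (q : SiegelDeltaQuot L e dV hdV dW hdW) : ratH L e dV hdV dW hdW) : HA L e dV hdV dW hdW)) *
            ((u : HA L e dV hdV dW hdW) * h))) ∂νN)) (hMIDc := hMIDc) (hMID := hMID)
  refine ⟨E₇, hd, hcont, fun s h hs => ?_, fun z hz => ?_⟩
  · rw [Finset.prod_singleton]
    exact heq s h hs
  · obtain ⟨C, A, r, -, hr, hle⟩ := hgr z hz
    exact ⟨C, A, r, hr, hle⟩

end Summit.HodgeConjecture.HodgeConjecture.Cruxes.HLiu418.K2LiuSiegelEisensteinMiddleTermPackageInstance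

end
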